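import Literature.AlgebraicGeometry.Motives.FanoSchemeOfLinesPoints
import Literature.AlgebraicGeometry.Motives.ZetaFunctionOfProjectiveSpace
import Literature.Combinatorics.Enumerative.GaussianBinomialTwoRowCoefficients
import HarnessLib

/-!
# Weil's Grassmannian (1949, p. 508) for lines: `#G(1, ℙⁿ)(𝔽_{q^m}) = [n+1; 2]_{q^m} = F(q^m)`,
# `F(X) = (X^{n+1} − 1)(X^{n+1} − X)/((X² − 1)(X² − X))`, and the cellular count
# `#G(1, ℙⁿ⁺¹)(𝔽_{q^m}) = Σ_{n ≥ a ≥ b ≥ 0} q^{m(a+b)} = Σ_{r ≤ 2n} (⌊min(r, 2n−r)/2⌋ + 1) q^{mr}`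

Topic `Literature/AlgebraicGeometry/Motives`; THEOREMS ONLY (no definition, no instance, no named fact;
D-0026).  The tree has the `k`-scheme `grassmannianOfLines n k = G(1, ℙⁿ_k) = G(2, n+1)` with its Plücker
embedding (`Motives/FanoSchemeOfLines`, Eisenbud–Harris §3.2) and the identification of its points with values
in ANY field `L ⊇ k` with the planes of `Lⁿ⁺¹`, `FanoScheme.grassmannianPointsEquiv :
G(1, ℙⁿ_k)(L) ≃ {W ≤ Lⁿ⁺¹ : dim W = 2}` (`Motives/FanoSchemeOfLinesPoints`); Cohn's count of the subspaces of a
finite vector space `#{W ≤ 𝔽_qⁿ : dim W = d} = [n; d]_q` (`LinearAlgebra/Subspace/GaussianBinomialCount`,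
`card_subspaces_fin_eq_qBinomial`, with the closed form `qBinomial_mul_prod_eq_prod`); the intrinsic point
counts `pointCount X m = #{P ∈ X(k̄) : φᵐP = P} = #X(L)` for `[L : k] = m` (`Motives/ZetaFunction(Proofs)`,
`pointCount_eq_pointCountOver_holds`) and an extension of every degree inside `k̄`
(`FiniteField.exists_intermediateField_finrank_eq`, `Motives/ZetaFunctionOfProjectiveSpace`); and the
coefficients of `[n+2; 2]_q` (`Combinatorics/Enumerative/GaussianBinomialTwoRowCoefficients`).  This file puts
them together: the number of `𝔽_{q^m}`-rational points of the Grassmannian of lines.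

## Sources, read on the page

A. Weil, *Numbers of solutions of equations in finite fields* [Weil1949], pp. 507–508 (held
`paper:doi-10-1090-s0002-9904-1949-09219-4`, p0011–p0012): «The evidence at hand seems to suggest that, if `V`
is a variety without singular points, defined over a field `K` of algebraic numbers, the Betti numbers of the
varieties `V_𝔭` … are equal to the Betti numbers of `V` (considered as a variety over complex numbers) … For
instance, consider the Grassmann variety `G_{m,r}`, the points of which are the `r`-dimensional linear
varieties in a projective `m`-dimensional space, over a field with `q` elements. The number of rational points
on the variety is easily seen to be `F(q)`, where `F` is the polynomial defined by
`F(X) = (X^{m+1} − 1)(X^{m+1} − X)⋯(X^{m+1} − Xʳ) / ((X^{r+1} − 1)(X^{r+1} − X)⋯(X^{r+1} − Xʳ))`. Then, if the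
above conjectures are true, the Poincaré polynomial of the Grassmann variety `G_{m,r}` over complex numbers must
be `F(X²)`. This is indeed so, as can easily be verified from the well-known results of Ehresmann [8]».
B. Kahn, *Zeta and L-functions of varieties and motives* [Kahn2020], §3.3 (held p0047): «The case of Grassmannian
varieties now seems easy, insofar as they are cellular».
H. Cohn, *Projective geometry over `𝔽₁` and the Gaussian binomial coefficients* [Cohn2004], Thm. 1: «If `q` is a
prime power, then `[n choose k]_q` is the number of `k`-dimensional subspaces of `𝔽_qⁿ`», with (3)
`[n, k]_q = (qⁿ − 1)(q^{n−1} − 1)⋯(q^{n−k+1} − 1)/((q^k − 1)(q^{k−1} − 1)⋯(q − 1))`.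
D. Eisenbud, J. Harris, *3264 and All That* [EisenbudHarris2016], §3.2.1–§3.2.2 (the Grassmannian `G(k, n)`,
`𝔾(1, n) = G(2, n+1)`, Plücker embedding and affine charts), §4.1 (Schubert cells of `G(2, n+1)`, indexed by
`n − 1 ≥ a ≥ b ≥ 0`, the cell `Σ°_{a,b}` an affine space of codimension `a + b`).
G. E. Andrews, *The Theory of Partitions* [Andrews1976Partitions], Thm. 3.1 (`[N+M; M] = Σ_n p(N, M, n) qⁿ`).

Dictionary: Weil's `G_{m,r}` with `r = 1`, `m = n` is the tree's `grassmannianOfLines n k`; his `F(X)` is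
`[n+1; 2]_X`; `q` below is `Nat.card k` and `Q = q^m = #𝔽_{q^m}`.

## What is here

* §1 (pure, any commutative ring) **Weil's `F` is the Gaussian binomial**: `qBinomial_mul_prod_weil`
  (`[m+1; r+1]_q · ∏_{i ≤ r} (q^{r+1} − qⁱ) = ∏_{i ≤ r} (q^{m+1} − qⁱ)` for `r ≤ m` — Weil's displayed `F(X)`
  against Cohn's (3), all `G_{m,r}` at once), `qBinomial_two_mul_weil` (`r = 1`:
  `[n+1; 2]_q · (q² − 1)(q² − q) = (q^{n+1} − 1)(q^{n+1} − q)`), and `qBinomial_two_mul_one_add`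
  (`[n+2; 2]_q · (1 + q) = [n+2; 1]_q · [n+1; 1]_q`: lines of `ℙⁿ⁺¹` = pairs of points / points on a line).
* §2 (any fields `k ⊆ L`) `GrassmannianOfLines.natCard_algPoints` (`#G(1,ℙⁿ_k)(L) = #{W ≤ Lⁿ⁺¹ : dim W = 2}`),
  `GrassmannianOfLines.finite_algPoints`, and for `L` finite **`GrassmannianOfLines.natCard_algPoints_eq_qBinomial`**
  (`#G(1,ℙⁿ_k)(L) = [n+1; 2]_{#L}` — Weil's «easily seen to be `F(q)`», by Cohn's Theorem 1),
  `GrassmannianOfLines.natCard_algPoints_mul` (Weil's fraction-free form), and for every `r` Weil's sentence at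
  the level of linear algebra, `natCard_subspaces_mul_prod_weil` (`#{W ≤ L^{m+1} : dim W = r+1} · ∏(Q^{r+1} − Qⁱ)
  = ∏(Q^{m+1} − Qⁱ)`; the scheme `grassmannian r m k` of `Motives/FanoSchemeOfPlanes` has no points
  equivalence for `r ≥ 2` in the tree, so only `r = 1` is carried to `pointCount`).
* §3 (`k` finite, `q = #k`, `m ≥ 1`) `pointCountOver_grassmannianOfLines`, **`pointCount_grassmannianOfLines`**
  (`#G(1,ℙⁿ)(𝔽_{q^m}) = [n+1; 2]_{q^m}` in `ℤ`), `pointCount_grassmannianOfLines_mul` (`· (Q²−1)(Q²−Q) =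
  (Q^{n+1}−1)(Q^{n+1}−Q)`, `Q = q^m`: Weil's `F(q^m)`), the CELLULAR COUNT **`pointCount_grassmannianOfLines_eq_sum_sum`**
  (`#G(1,ℙⁿ⁺¹)(𝔽_{q^m}) = Σ_{a ≤ n} Σ_{b ≤ a} q^{m(a+b)}` in `ℕ` — one affine cell `𝔸^{a+b}` per Schubert symbol,
  Kahn's «cellular»), the POLYNOMIAL COUNT **`pointCount_grassmannianOfLines_eq_sum_closed`** (`= Σ_{r ≤ 2n}
  (⌊min(r, 2n−r)/2⌋ + 1) q^{mr}`) and its `ℚ`-cast `pointCount_grassmannianOfLines_cast` in the normal form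
  `Σ_{r ≤ N} c_r q^{rm}` consumed by `Motives/PolynomialPointCountsBettiNumbers`; the comparison with projective
  spaces **`pointCount_grassmannianOfLines_mul_pointCount_projectiveLine`**
  (`#G(1,ℙⁿ⁺¹)·#ℙ¹ = #ℙⁿ⁺¹·#ℙⁿ` over every `𝔽_{q^m}`); and the first cases `pointCount_grassmannianOfLines_zero`
  (`G(1, ℙ⁰) = ∅`: `0`), `pointCount_grassmannianOfLines_one` (`G(1, ℙ¹) = pt`: `1`),
  `pointCount_grassmannianOfLines_two` (`G(1, ℙ²) = ℙ²^∨`: `Q² + Q + 1 = #ℙ²(𝔽_Q)`),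
  `pointCount_grassmannianOfLines_three` (`G(1, ℙ³)`, the Klein quadric: `(Q² + 1)(Q² + Q + 1)`).

What is NOT here: the zeta function and the Weil conjectures for `G(1, ℙⁿ)` (sequels), the Schubert CELLS as
subschemes (only their numerical shadow), `G_{m,r}` for `r ≥ 2` as a scheme count.  HC is not touched.

## References

* [Weil1949] A. Weil, *Numbers of solutions of equations in finite fields*, Bull. AMS 55 (1949) 497–508, p. 508.
* [Kahn2020] B. Kahn, *Zeta and L-functions of varieties and motives*, LMS LN 462 (2020), §3.3.
* [Cohn2004] H. Cohn, *Projective geometry over `𝔽₁` and the Gaussian binomial coefficients*, Amer. Math.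
  Monthly 111 (2004), Thm. 1 and (3).
* [EisenbudHarris2016] D. Eisenbud, J. Harris, *3264 and All That* (2016), §3.2.1–§3.2.2, §4.1.
* [Andrews1976Partitions] G. E. Andrews, *The Theory of Partitions* (1976), §3.2 Thm. 3.1.
* [LidlNiederreiter1996] R. Lidl, H. Niederreiter, *Finite Fields*, Thm. 2.5–2.6 (extensions of each degree).

## Provenance

Lane `lit-hodgefound` (summit `HodgeConjecture`, Track 2 foundations library, Layer B: motives / zeta
functions — Weil's verification of his conjectures on Grassmannians), seat `lit-hodgefound-p29`
(literature-prover, generation 51, row g51-#2).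
-/

universe u

open CategoryTheory AlgebraicGeometry Function Finset
open Literature.Combinatorics.Enumerative
open Literature.Combinatorics.Enumerative.GaussianBinomialTwoRows

noncomputable section

namespace Literature.AlgebraicGeometry.Motives

/-! ### §1 Weil's `F(X)` is the Gaussian binomial (pure algebra) -/

section Weil

variable {R : Type*} [CommRing R]

/-- **Weil's `F` against Cohn's closed form, all `G_{m,r}` at once**: for `r ≤ m`,
`[m+1; r+1]_q · ∏_{i=0}^{r} (q^{r+1} − qⁱ) = ∏_{i=0}^{r} (q^{m+1} − qⁱ)`, i.e. `F(X) = (X^{m+1} − 1)(X^{m+1} − X)⋯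
(X^{m+1} − Xʳ)/((X^{r+1} − 1)(X^{r+1} − X)⋯(X^{r+1} − Xʳ))` IS `[m+1; r+1]_X` (division-free; from the tree's
`qBinomial_mul_prod_eq_prod`: `[N; k]·∏_{i<k}(1 − q^{i+1}) = ∏_{i<k}(1 − q^{N−i})`, multiplied by
`∏_{i<k} (−qⁱ)` and reflected). [cite: Weil1949, p. 508] [cite: Cohn2004, (3)] -/
theorem qBinomial_mul_prod_weil (q : R) {m r : ℕ} (hr : r ≤ m) :
    qBinomial q (m + 1) (r + 1) * ∏ i ∈ range (r + 1), (q ^ (r + 1) - q ^ i) =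
      ∏ i ∈ range (r + 1), (q ^ (m + 1) - q ^ i) := by
  have h := LinearAlgebra.Subspace.qBinomial_mul_prod_eq_prod q (show r + 1 ≤ m + 1 by omega)
  -- `∏_{i<k} (q^N − q^i) = ∏_{i<k} q^i · ∏_{i<k} (q^{N-i} − 1)` and reflect `i ↦ k-1-i`
  have key : ∀ N : ℕ, r + 1 ≤ N →
      ∏ i ∈ range (r + 1), (q ^ N - q ^ i) =
        (∏ i ∈ range (r + 1), (-q ^ i)) * ∏ i ∈ range (r + 1), (1 - q ^ (N - i)) := by
    intro N hN
    rw [← prod_mul_distrib]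
    refine prod_congr rfl fun i hi => ?_
    rw [mem_range] at hi
    rw [show q ^ N = q ^ i * q ^ (N - i) by rw [← pow_add]; congr 1; omega]
    ring
  have hrefl : ∏ i ∈ range (r + 1), (1 - q ^ (r + 1 - i)) = ∏ i ∈ range (r + 1), (1 - q ^ (i + 1)) := by
    rw [← prod_range_reflect (fun i => 1 - q ^ (i + 1)) (r + 1)]
    refine prod_congr rfl fun i hi => ?_
    rw [mem_range] at hi
    congr 2
    omega
  rw [key (r + 1) le_rfl, key (m + 1) (by omega), hrefl, mul_left_comm, h]

/-- **Weil's `F` for the Grassmannian of lines (`r = 1`)**: `[n+1; 2]_q · (q² − 1)(q² − q) = (q^{n+1} − 1)(q^{n+1} − q)`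
(also for `n = 0`, where both sides vanish: `G(1, ℙ⁰) = ∅`). [cite: Weil1949, p. 508] -/
theorem qBinomial_two_mul_weil (q : R) (n : ℕ) :
    qBinomial q (n + 1) 2 * ((q ^ 2 - 1) * (q ^ 2 - q)) = (q ^ (n + 1) - 1) * (q ^ (n + 1) - q) := by
  rcases Nat.eq_zero_or_pos n with rfl | hn
  · rw [zero_add, qBinomial_eq_zero_of_lt q Nat.one_lt_two, pow_one, sub_self, zero_mul, mul_zero]
  · have h := qBinomial_mul_prod_weil q (m := n) (r := 1) hn
    simp only [prod_range_succ, prod_range_zero, one_mul, pow_zero, pow_one, show 1 + 1 = 2 from rfl] at h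
    linear_combination h

/-- `[n+2; 2]_q · (1 + q) = [n+2; 1]_q · [n+1; 1]_q` — for `q` a prime power: (lines of `ℙⁿ⁺¹(𝔽_q)`) ×
(points on a line) = (ordered pairs of distinct points)/(q−1)… i.e. `#G(1,ℙⁿ⁺¹)·#ℙ¹ = #ℙⁿ⁺¹·#ℙⁿ`; here as a
polynomial identity, by induction from the `q`-Pascal rule. [cite: Cohn2004, (2)–(3)] -/
theorem qBinomial_two_mul_one_add (q : R) (n : ℕ) :
    qBinomial q (n + 2) 2 * (1 + q) = qBinomial q (n + 2) 1 * qBinomial q (n + 1) 1 := by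
  induction n with
  | zero =>
    rw [zero_add, qBinomial_self, one_mul, show (2 : ℕ) = 1 + 1 from rfl, qBinomial_succ_succ, pow_one,
      qBinomial_self, qBinomial_zero_right, mul_one, mul_one, add_comm]
  | succ n ih =>
    have h1 : qBinomial q (n + 1 + 2) 2 = q ^ 2 * qBinomial q (n + 2) 2 + qBinomial q (n + 2) 1 :=
      qBinomial_succ_succ q (n + 2) 1
    have h2 : qBinomial q (n + 1 + 2) 1 = q * qBinomial q (n + 2) 1 + 1 := by
      rw [show n + 1 + 2 = (n + 2) + 1 from rfl, qBinomial_succ_succ, pow_one, qBinomial_zero_right]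
    have h3 : qBinomial q (n + 2) 1 = q * qBinomial q (n + 1) 1 + 1 := by
      rw [qBinomial_succ_succ, pow_one, qBinomial_zero_right]
    rw [show n + 1 + 1 = n + 2 from rfl]
    linear_combination (1 + q) * h1 + q ^ 2 * ih - qBinomial q (n + 2) 1 * h2 -
      q * qBinomial q (n + 2) 1 * h3

end Weil

/-! ### §2 `G(1, ℙⁿ_k)(L)` for any fields `k ⊆ L`: planes in `Lⁿ⁺¹` -/

namespace GrassmannianOfLines

section AnyField

variable {k : Type u} [Field k] {n : ℕ} {L : Type u} [Field L] [Algebra k L]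

/-- **`#G(1, ℙⁿ_k)(L) = #{W ≤ Lⁿ⁺¹ : dim_L W = 2}`** for any field `L ⊇ k` — Weil's «the points of which are the
`r`-dimensional linear varieties in a projective `m`-dimensional space» (`r = 1`), by the tree's
`FanoScheme.grassmannianPointsEquiv`. [cite: Weil1949, p. 508] [cite: EisenbudHarris2016, §3.2.2] -/
theorem natCard_algPoints :
    Nat.card (AlgPoints (grassmannianOfLines n k) L) =
      Nat.card {W : Submodule L (Fin (n + 1) → L) // Module.finrank L W = 2} :=
  Nat.card_congr FanoScheme.grassmannianPointsEquiv

/-- Over a finite field `L`, `G(1, ℙⁿ_k)(L)` is finite. [cite: Weil1949, p. 508] -/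
theorem finite_algPoints [Finite L] : Finite (AlgPoints (grassmannianOfLines n k) L) := by
  haveI : Finite (Submodule L (Fin (n + 1) → L)) :=
    Finite.of_injective (fun W : Submodule L (Fin (n + 1) → L) => (W : Set (Fin (n + 1) → L)))
      SetLike.coe_injective
  exact Finite.of_equiv _ FanoScheme.grassmannianPointsEquiv.symm

/-- **Weil: «The number of rational points on the variety is easily seen to be `F(q)`»** — for the
Grassmannian of lines over a finite field `L` with `Q` elements, `#G(1, ℙⁿ_k)(L) = [n+1; 2]_Q` (Cohn's
Theorem 1, the tree's `card_subspaces_fin_eq_qBinomial`). [cite: Weil1949, p. 508] [cite: Cohn2004, Thm. 1] -/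
theorem natCard_algPoints_eq_qBinomial [Finite L] :
    (Nat.card (AlgPoints (grassmannianOfLines n k) L) : ℤ) = qBinomial (Nat.card L : ℤ) (n + 1) 2 := by
  rw [natCard_algPoints]
  exact LinearAlgebra.Subspace.card_subspaces_fin_eq_qBinomial (k := L) (n + 1) 2

/-- Weil's displayed `F`, fraction-free: `#G(1, ℙⁿ_k)(L) · (Q² − 1)(Q² − Q) = (Q^{n+1} − 1)(Q^{n+1} − Q)`,
`Q = #L`. [cite: Weil1949, p. 508] -/
theorem natCard_algPoints_mul [Finite L] :
    (Nat.card (AlgPoints (grassmannianOfLines n k) L) : ℤ) *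
        (((Nat.card L : ℤ) ^ 2 - 1) * ((Nat.card L : ℤ) ^ 2 - Nat.card L)) =
      ((Nat.card L : ℤ) ^ (n + 1) - 1) * ((Nat.card L : ℤ) ^ (n + 1) - Nat.card L) := by
  rw [natCard_algPoints_eq_qBinomial]
  exact qBinomial_two_mul_weil _ n

end AnyField

end GrassmannianOfLines

/-- **Weil's sentence for every `G_{m,r}`, at the level of linear algebra**: over a finite field `L` with `Q`
elements, the `(r+1)`-dimensional subspaces of `L^{m+1}` — the `r`-dimensional linear subvarieties of `ℙᵐ(L)` —
number `F(Q)`: `#{W ≤ L^{m+1} : dim W = r+1} · ∏_{i ≤ r}(Q^{r+1} − Qⁱ) = ∏_{i ≤ r}(Q^{m+1} − Qⁱ)` (`r ≤ m`).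
(The tree's scheme `grassmannian r m k` of `Motives/FanoSchemeOfPlanes` lacks the points equivalence for
`r ≥ 2`, so only `r = 1` is carried to `pointCount` below.) [cite: Weil1949, p. 508] [cite: Cohn2004, Thm. 1 and (3)] -/
theorem natCard_subspaces_mul_prod_weil (L : Type u) [Field L] [Finite L] {m r : ℕ} (hr : r ≤ m) :
    (Nat.card {W : Submodule L (Fin (m + 1) → L) // Module.finrank L W = r + 1} : ℤ) *
        ∏ i ∈ range (r + 1), ((Nat.card L : ℤ) ^ (r + 1) - (Nat.card L : ℤ) ^ i) =
      ∏ i ∈ range (r + 1), ((Nat.card L : ℤ) ^ (m + 1) - (Nat.card L : ℤ) ^ i) := by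
  rw [LinearAlgebra.Subspace.card_subspaces_fin_eq_qBinomial (k := L) (m + 1) (r + 1)]
  exact qBinomial_mul_prod_weil _ hr

/-! ### §3 The point counts `#G(1, ℙⁿ)(𝔽_{q^m})` -/

section PointCount

variable {k : Type u} [Field k] {n : ℕ}

/-- `#G(1, ℙⁿ_k)(L) = [n+1; 2]_{#L}` as the tree's naive count `pointCountOver` over a finite field `L ⊇ k`.
[cite: Weil1949, p. 508] -/
theorem pointCountOver_grassmannianOfLines (L : Type u) [Field L] [Algebra k L] [Finite L] :
    (pointCountOver (grassmannianOfLines n k) L : ℤ) = qBinomial (Nat.card L : ℤ) (n + 1) 2 :=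
  GrassmannianOfLines.natCard_algPoints_eq_qBinomial

variable [Finite k]

/-- **`#G(1, ℙⁿ)(𝔽_{q^m}) = [n+1; 2]_{q^m}`** for the intrinsic count `pointCount` (`k̄`-points fixed by `φᵐ`;
`m ≥ 1`): Weil's `F(q^m)` for the Grassmannian of lines, through an extension `L ⊆ k̄` of degree `m`
(`[L : k] = m`, `#L = q^m`). [cite: Weil1949, p. 508] [cite: Cohn2004, Thm. 1] -/
theorem pointCount_grassmannianOfLines {m : ℕ} (hm : 0 < m) :
    (pointCount (grassmannianOfLines n k) m : ℤ) = qBinomial ((Nat.card k : ℤ) ^ m) (n + 1) 2 := by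
  obtain ⟨L, hLfin, hL⟩ := FiniteField.exists_intermediateField_finrank_eq (k := k) hm
  haveI := hLfin
  haveI : Module.Finite k L := Module.Finite.of_finite
  rw [pointCount_eq_pointCountOver_holds (X := grassmannianOfLines n k) L hL hm,
    pointCountOver_grassmannianOfLines, Module.natCard_eq_pow_finrank (K := k) (V := L), hL, Nat.cast_pow]

/-- Weil's `F(q^m)`, fraction-free: `#G(1, ℙⁿ)(𝔽_Q) · (Q² − 1)(Q² − Q) = (Q^{n+1} − 1)(Q^{n+1} − Q)`, `Q = q^m`.
[cite: Weil1949, p. 508] -/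
theorem pointCount_grassmannianOfLines_mul {m : ℕ} (hm : 0 < m) :
    (pointCount (grassmannianOfLines n k) m : ℤ) *
        ((((Nat.card k : ℤ) ^ m) ^ 2 - 1) * (((Nat.card k : ℤ) ^ m) ^ 2 - (Nat.card k : ℤ) ^ m)) =
      (((Nat.card k : ℤ) ^ m) ^ (n + 1) - 1) * (((Nat.card k : ℤ) ^ m) ^ (n + 1) - (Nat.card k : ℤ) ^ m) := by
  rw [pointCount_grassmannianOfLines hm]
  exact qBinomial_two_mul_weil _ n

/-- **The cellular count: `#G(1, ℙⁿ⁺¹)(𝔽_{q^m}) = Σ_{a=0}^{n} Σ_{b=0}^{a} q^{m(a+b)}`** (in `ℕ`) — one affine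
space `𝔸^{a+b}` for every Schubert symbol `n ≥ a ≥ b ≥ 0` of `G(2, n+2)` (Kahn: «The case of Grassmannian
varieties now seems easy, insofar as they are cellular»; Eisenbud–Harris §4.1); numerically it is
`qBinomial_two_eq_sum_sum`. [cite: Kahn2020, §3.3] [cite: EisenbudHarris2016, §4.1] [cite: Andrews1976Partitions, §3.2 Thm. 3.1] -/
theorem pointCount_grassmannianOfLines_eq_sum_sum {m : ℕ} (hm : 0 < m) :
    pointCount (grassmannianOfLines (n + 1) k) m =
      ∑ a ∈ range (n + 1), ∑ b ∈ range (a + 1), Nat.card k ^ (m * (a + b)) := by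
  have h := pointCount_grassmannianOfLines (n := n + 1) (k := k) hm
  rw [qBinomial_two_eq_sum_sum] at h
  simp_rw [← pow_mul] at h
  exact_mod_cast h

/-- **The polynomial count: `#G(1, ℙⁿ⁺¹)(𝔽_{q^m}) = Σ_{r=0}^{2n} (⌊min(r, 2n−r)/2⌋ + 1) q^{mr}`** (in `ℕ`) — the
number of cells of dimension `r` is the number `p(n, 2, r)` of partitions of `r` into at most two parts each
`≤ n` (Andrews Thm. 3.1), here in closed form. [cite: Weil1949, p. 508] [cite: Andrews1976Partitions, §3.2 Thm. 3.1] -/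
theorem pointCount_grassmannianOfLines_eq_sum_closed {m : ℕ} (hm : 0 < m) :
    pointCount (grassmannianOfLines (n + 1) k) m =
      ∑ r ∈ range (2 * n + 1), (min r (2 * n - r) / 2 + 1) * Nat.card k ^ (m * r) := by
  have h := pointCount_grassmannianOfLines (n := n + 1) (k := k) hm
  rw [qBinomial_two_eq_sum_closed] at h
  simp_rw [← pow_mul] at h
  exact_mod_cast h

/-- The polynomial count in the normal form `#X(𝔽_{q^m}) = Σ_{r ≤ N} c_r q^{rm}` (`ℚ`-valued, `N = 2n`,
`c_r = ⌊min(r, 2n−r)/2⌋ + 1`) consumed by `Motives/PolynomialPointCountsBettiNumbers` (Göttsche's Remark 1.2.2: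
such a count forces `b_{2r} = c_r`, `b_{odd} = 0`). [cite: Weil1949, p. 508] -/
theorem pointCount_grassmannianOfLines_cast {m : ℕ} (hm : 0 < m) :
    (pointCount (grassmannianOfLines (n + 1) k) m : ℚ) =
      ∑ r ∈ range (2 * n + 1),
        (fun r => ((min r (2 * n - r) / 2 + 1 : ℕ) : ℚ)) r * (Nat.card k : ℚ) ^ (r * m) := by
  rw [pointCount_grassmannianOfLines_eq_sum_closed hm, Nat.cast_sum]
  refine sum_congr rfl fun r _ => ?_
  rw [Nat.cast_mul, Nat.cast_pow, mul_comm m r]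

/-- **`#G(1, ℙⁿ⁺¹)(𝔽_Q) · #ℙ¹(𝔽_Q) = #ℙⁿ⁺¹(𝔽_Q) · #ℙⁿ(𝔽_Q)`** (`Q = q^m`): a line of `ℙⁿ⁺¹` is determined by an
ordered pair of distinct points, of which it carries `#ℙ¹·(#ℙ¹ − 1)`… — here as the identity
`[n+2; 2]·(1 + Q) = [n+2; 1]·[n+1; 1]` against the tree's `pointCount_projectiveSpace`.
[cite: Cohn2004, (2)–(3)] [cite: Weil1949, p. 508] -/
theorem pointCount_grassmannianOfLines_mul_pointCount_projectiveLine {m : ℕ} (hm : 0 < m) :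
    pointCount (grassmannianOfLines (n + 1) k) m * pointCount (projectiveSpace 1 k) m =
      pointCount (projectiveSpace (n + 1) k) m * pointCount (projectiveSpace n k) m := by
  have h := qBinomial_two_mul_one_add ((Nat.card k : ℤ) ^ m) n
  rw [qBinomial_succ_one_eq_geom_sum, qBinomial_succ_one_eq_geom_sum,
    ← pointCount_grassmannianOfLines (n := n + 1) (k := k) hm] at h
  have h1 : (pointCount (projectiveSpace 1 k) m : ℤ) = 1 + (Nat.card k : ℤ) ^ m := by
    rw [pointCount_projectiveLine hm]; push_cast; ring
  have h2 : ∀ N : ℕ, (pointCount (projectiveSpace N k) m : ℤ) =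
      ∑ i ∈ range (N + 1), ((Nat.card k : ℤ) ^ m) ^ i := fun N => by
    rw [pointCount_projectiveSpace hm, Nat.cast_sum]
    exact sum_congr rfl fun i _ => by rw [Nat.cast_pow, pow_mul]
  have e : (pointCount (grassmannianOfLines (n + 1) k) m : ℤ) * pointCount (projectiveSpace 1 k) m =
      (pointCount (projectiveSpace (n + 1) k) m : ℤ) * pointCount (projectiveSpace n k) m := by
    rw [h1, h2, h2, h]
  exact_mod_cast e

/-- `G(1, ℙ⁰) = ∅`: `#G(1, ℙ⁰)(𝔽_{q^m}) = 0` (`[1; 2] = 0`; no lines in a point). [cite: Weil1949, p. 508] -/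
theorem pointCount_grassmannianOfLines_zero {m : ℕ} (hm : 0 < m) :
    pointCount (grassmannianOfLines 0 k) m = 0 := by
  have h := pointCount_grassmannianOfLines (n := 0) (k := k) hm
  rw [zero_add, qBinomial_eq_zero_of_lt _ Nat.one_lt_two] at h
  exact_mod_cast h

/-- `G(1, ℙ¹) = pt`: `#G(1, ℙ¹)(𝔽_{q^m}) = 1` (`[2; 2] = 1`; the line itself). [cite: Weil1949, p. 508] -/
theorem pointCount_grassmannianOfLines_one {m : ℕ} (hm : 0 < m) :
    pointCount (grassmannianOfLines 1 k) m = 1 := by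
  have h := pointCount_grassmannianOfLines (n := 1) (k := k) hm
  rw [qBinomial_self] at h
  exact_mod_cast h

/-- `G(1, ℙ²) = ℙ²^∨`: `#G(1, ℙ²)(𝔽_Q) = Q² + Q + 1 = #ℙ²(𝔽_Q)` (the lines of a projective plane are the points
of the dual plane; `[3; 2] = [3; 1]`). [cite: Weil1949, p. 508] [cite: Cohn2004, (2)] -/
theorem pointCount_grassmannianOfLines_two {m : ℕ} (hm : 0 < m) :
    pointCount (grassmannianOfLines 2 k) m = Nat.card k ^ (2 * m) + Nat.card k ^ m + 1 ∧
      pointCount (grassmannianOfLines 2 k) m = pointCount (projectiveSpace 2 k) m := by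
  have h := pointCount_grassmannianOfLines_eq_sum_sum (n := 1) (k := k) hm
  rw [sum_range_succ, sum_range_one, sum_range_one, sum_range_succ, sum_range_one, add_zero, mul_zero,
    pow_zero, add_zero, mul_one, show 1 + 1 = 2 from rfl] at h
  refine ⟨by rw [h, mul_comm]; ring, ?_⟩
  rw [h, pointCount_projectiveSpace hm, sum_range_succ, sum_range_succ, sum_range_one, mul_zero, pow_zero,
    mul_one]
  ring

/-- `G(1, ℙ³)`, the Klein quadric: `#G(1, ℙ³)(𝔽_Q) = (Q² + 1)(Q² + Q + 1) = Q⁴ + Q³ + 2Q² + Q + 1` (cells of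
dimensions `0, 1, 2, 2, 3, 4`: `b₄(G(2,4)) = 2`). [cite: Weil1949, p. 508] [cite: EisenbudHarris2016, §4.1] -/
theorem pointCount_grassmannianOfLines_three {m : ℕ} (hm : 0 < m) :
    pointCount (grassmannianOfLines 3 k) m =
      (Nat.card k ^ (2 * m) + 1) * (Nat.card k ^ (2 * m) + Nat.card k ^ m + 1) := by
  rw [pointCount_grassmannianOfLines_eq_sum_closed (n := 2) hm]
  simp only [sum_range_succ, sum_range_zero, show 2 * 2 = 4 from rfl]
  norm_num
  ring

end PointCount

end Literature.AlgebraicGeometry.Motives
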